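import Summits.QuantumFields.YangMills.Theorems.ColdStartUniversalityShenZhuZhuTorusConcentrationSU2
import HarnessLib

/-!
# Linear combinations of Wilson loops (plaquette densities, loop families): Gaussian concentration under every infinite-volume limit point
# and on every torus, three-dimensional `SU(2)` lattice Yang–Mills at strong coupling

Seat `ym-line-csu-p1` (g38), route `ColdStartUniversality` of `Summits/QuantumFields/YangMills`, helper file G12 — calculus of link-Lipschitz
cylinder observables (restriction to a larger link set, linear combinations) and the resulting concentration of `A = Σ_k a_k W_{C_k}` for a
finite family of closed lattice walks `C_k` (e.g. the plaquette density `|𝒫|⁻¹ Σ_{p∈𝒫} W_p` of a finite set of plaquettes): the Lipschitz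
constant of `A` in the link `e` is `Σ_k |a_k| mult_{C_k}(e)/√N`, so
`μ{|A − ⟨A⟩| ≥ r} ≤ 2 exp(−K r² / Σ_e (Σ_k |a_k| mult_{C_k}(e))²)`, `K = 1 − 24|β|` (limit points, 't Hooft `|β| < 1/24`) resp. `1 − 12|β'|` (every torus,
tree coupling `|β'| < 1/12`).  For `n` plaquettes with weights `1/n`, every link lying in at most `4` of them (`d = 3`), the denominator is `≤ 64/n`:
SELF-AVERAGING of the plaquette density with Gaussian bounds `2exp(−K n r²/64)` (the arithmetic is left to the user; the theorem keeps the exact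
denominator).

* `szz_twoSided_su2_sharp`, `torus_twoSided_su2_uniform` — two-sided Gaussian concentration of a general smooth link-Lipschitz cylinder observable
  (limit points / every torus), `2 exp(−K r²/(2Σ_e ℓ_e²))`.
* `exists_smooth_linkLipschitz_extend` — a smooth link-Lipschitz cylinder over `Λ₁ ⊆ Λ` is one over `Λ` (constants extended by `0`).
* `exists_smooth_linkLipschitz_loopFamily` — `Σ_k a_k W_{C_k}` is a smooth cylinder over `⋃_k links(C_k)`, `(Σ_k |a_k| mult_{C_k}(e))/√N`-Lipschitz in `e`.
* ★★★ `szz_loopFamily_twoSided_su2` (limit points), ★★★ `torus_loopFamily_twoSided_su2_uniform` (every torus on which `⋃_k links(C_k)` stays injective).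

THEOREMS ONLY, no definition, no sorry.  HONEST FRAMING: STRONG coupling, fixed lattice, `SU(2)`, `d = 3`; no area law, nothing at weak coupling /
in the continuum, nothing `K`-uniform along the route's scaling (`UniformColdStartMixing`, 24809, ASIDE, not restated); no crux, rung or summit
statement is proved; the Yang–Mills mass gap is NOT proved.

References: H. Shen, R. Zhu, X. Zhu, CMP 400 (2023) 805–851 = arXiv:2204.12737, Thm 1.4, Cor. 1.5, Cor. 4.8 [ShenZhuZhu2022]; M. Ledoux (2001) §5.1.
-/

set_option autoImplicit false

noncomputable section

namespace Summit.QuantumFields.YangMills.Theorems.ColdStartUniversality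

open MeasureTheory ProbabilityTheory Finset Filter Set Function
open scoped BigOperators NNReal ENNReal Topology Matrix Matrix.Norms.Frobenius ContDiff
open SimpleGraph
open Literature.Probability.LatticeModels (Site zdGraph)
open Literature.Probability.Process Literature.MathematicalPhysics.QuantumFieldTheory
open Literature.MathematicalPhysics.QuantumLattice (fundamentalRep fundamentalLatticeRep continuous_fundamentalRep fundamentalRep_apply
  torusEdge torusLift infiniteVolumeLimitPoints LGConfig normalisedCharacter wilsonLoopObs)
open Summit.Ventures.YMGap.RobustBall (dartMult dartMult_eq_zero_of_not_mem)

/-! ## §1. Two-sided concentration of a general link-Lipschitz cylinder observable -/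

/-- **Two-sided Gaussian concentration of Lipschitz cylinder observables under every infinite-volume limit point, `|β| < 1/24`:**
`μ{|F − ⟨F⟩_μ| ≥ r} ≤ 2 exp(−(1 − 24|β|) r²/(2 Σ_e ℓ_e²))` for `F = f((U_e)_(e∈Λ))`, `f` smooth and `ℓ_e`-Lipschitz in the link `e` (Frobenius distance),
`Σ_e ℓ_e² > 0`, `r ≥ 0`.  The Yang–Mills mass gap is NOT proved. [cite: ShenZhuZhu2022, Theorem 1.4] -/
theorem szz_twoSided_su2_sharp {β : ℝ} (hβ : |β| < 1 / 24)
    {μ : Measure (LGConfig 3 (Matrix.specialUnitaryGroup (Fin 2) ℂ))}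
    (hμ : μ ∈ infiniteVolumeLimitPoints (d := 3) (fundamentalRep (Fin 2)) (((2 : ℕ) : ℝ) * β))
    (Λ : Finset (Literature.MathematicalPhysics.QuantumLattice.ZdEdge 3)) (f : (↥Λ → Matrix (Fin 2) (Fin 2) ℂ) → ℝ) (hf : ContDiff ℝ ∞ f)
    (ℓ : ↥Λ → ℝ) (hℓ : ∀ e, 0 ≤ ℓ e) (hS : 0 < ∑ e, ℓ e ^ 2)
    (hLip : ∀ (e : ↥Λ) (M M' : ↥Λ → Matrix.specialUnitaryGroup (Fin 2) ℂ), (∀ e', e' ≠ e → M e' = M' e') →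
      |f (fun e' => (M e' : Matrix (Fin 2) (Fin 2) ℂ)) - f (fun e' => (M' e' : Matrix (Fin 2) (Fin 2) ℂ))| ≤ ℓ e * suFrobDist (M e) (M' e))
    {r : ℝ} (hr : 0 ≤ r) :
    μ.real {U | r ≤ |matrixCylinder Λ f U - ∫ V, matrixCylinder Λ f V ∂μ|} ≤
      2 * Real.exp (-((1 - 24 * |β|) * r ^ 2 / (2 * ∑ e, ℓ e ^ 2))) := by
  classical
  obtain ⟨Ls, hLs, hprob, hlim⟩ := hμ
  haveI := hprob
  have hμ' : μ ∈ infiniteVolumeLimitPoints (d := 3) (fundamentalRep (Fin 2)) (((2 : ℕ) : ℝ) * β) := ⟨Ls, hLs, hprob, hlim⟩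
  have hup := szz_concentration_su2_sharp hβ hμ' Λ f hf ℓ hℓ hS hLip hr
  have hf' : ContDiff ℝ ∞ (fun m => - f m) := hf.neg
  have hLip' : ∀ (e : ↥Λ) (M M' : ↥Λ → Matrix.specialUnitaryGroup (Fin 2) ℂ), (∀ e', e' ≠ e → M e' = M' e') →
      |(fun m => - f m) (fun e' => (M e' : Matrix (Fin 2) (Fin 2) ℂ)) -
          (fun m => - f m) (fun e' => (M' e' : Matrix (Fin 2) (Fin 2) ℂ))| ≤ ℓ e * suFrobDist (M e) (M' e) := by
    intro e M M' h
    simp only [neg_sub_neg]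
    rw [abs_sub_comm]
    exact hLip e M M' h
  have hlow := szz_concentration_su2_sharp hβ hμ' Λ (fun m => - f m) hf' ℓ hℓ hS hLip' hr
  have hF' : matrixCylinder Λ (fun m => - f m) = fun U => - matrixCylinder Λ f U := by funext U; rfl
  rw [hF'] at hlow
  simp only [integral_neg] at hlow
  have hsub : {U : LGConfig 3 (Matrix.specialUnitaryGroup (Fin 2) ℂ) | r ≤ |matrixCylinder Λ f U - ∫ V, matrixCylinder Λ f V ∂μ|} ⊆
      {U | (∫ V, matrixCylinder Λ f V ∂μ) + r ≤ matrixCylinder Λ f U} ∪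
        {U | -(∫ V, matrixCylinder Λ f V ∂μ) + r ≤ - matrixCylinder Λ f U} := by
    intro U hU
    simp only [mem_setOf_eq, mem_union] at hU ⊢
    rcases le_abs'.1 hU with h | h
    · right; linarith
    · left; linarith
  calc μ.real {U | r ≤ |matrixCylinder Λ f U - ∫ V, matrixCylinder Λ f V ∂μ|}
      ≤ μ.real ({U | (∫ V, matrixCylinder Λ f V ∂μ) + r ≤ matrixCylinder Λ f U} ∪
          {U | -(∫ V, matrixCylinder Λ f V ∂μ) + r ≤ - matrixCylinder Λ f U}) := measureReal_mono hsub
    _ ≤ μ.real {U | (∫ V, matrixCylinder Λ f V ∂μ) + r ≤ matrixCylinder Λ f U} +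
          μ.real {U | -(∫ V, matrixCylinder Λ f V ∂μ) + r ≤ - matrixCylinder Λ f U} := measureReal_union_le _ _
    _ ≤ Real.exp (-((1 - 24 * |β|) * r ^ 2 / (2 * ∑ e, ℓ e ^ 2))) +
          Real.exp (-((1 - 24 * |β|) * r ^ 2 / (2 * ∑ e, ℓ e ^ 2))) := add_le_add hup hlow
    _ = 2 * Real.exp (-((1 - 24 * |β|) * r ^ 2 / (2 * ∑ e, ℓ e ^ 2))) := by ring

/-- **Two-sided Gaussian concentration of Lipschitz cylinder observables on every torus, uniformly in the volume, `|β'| < 1/12`:**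
`μ_{L,β'}{|F − ⟨F⟩| ≥ r} ≤ 2 exp(−(1 − 12|β'|) r²/(2 Σ_e ℓ_e²))`, `F = f((U_e)_(e∈Λ)) ∘ torusLift`, `Λ` injective on the torus.  The Yang–Mills mass
gap is NOT proved. [cite: ShenZhuZhu2022, Corollary 4.4 (4.11)] -/
theorem torus_twoSided_su2_uniform {β' : ℝ} (hβ : |β'| < 1 / 12) (L : ℕ) [NeZero L]
    (Λ : Finset (Literature.MathematicalPhysics.QuantumLattice.ZdEdge 3)) (hinj : Set.InjOn (torusEdge (d := 3) L) ↑Λ)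
    (f : (↥Λ → Matrix (Fin 2) (Fin 2) ℂ) → ℝ) (hf : ContDiff ℝ ∞ f) (ℓ : ↥Λ → ℝ) (hℓ : ∀ e, 0 ≤ ℓ e) (hS : 0 < ∑ e, ℓ e ^ 2)
    (hLip : ∀ (e : ↥Λ) (M M' : ↥Λ → Matrix.specialUnitaryGroup (Fin 2) ℂ), (∀ e', e' ≠ e → M e' = M' e') →
      |f (fun e' => (M e' : Matrix (Fin 2) (Fin 2) ℂ)) - f (fun e' => (M' e' : Matrix (Fin 2) (Fin 2) ℂ))| ≤ ℓ e * suFrobDist (M e) (M' e))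
    {r : ℝ} (hr : 0 ≤ r) :
    ((wilsonMeasure (d := 3) (L := L) (fundamentalRep (Fin 2)) β')).real {V | r ≤ |matrixCylinder Λ f (torusLift L V) - ∫ V', matrixCylinder Λ f (torusLift L V') ∂(wilsonMeasure (d := 3) (L := L) (fundamentalRep (Fin 2)) β')|} ≤
      2 * Real.exp (-((1 - 12 * |β'|) * r ^ 2 / (2 * ∑ e, ℓ e ^ 2))) := by
  classical
  set μ' : Measure (GaugeConfig 3 L (Matrix.specialUnitaryGroup (Fin 2) ℂ)) := (wilsonMeasure (d := 3) (L := L) (fundamentalRep (Fin 2)) β') with hμ'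
  haveI : IsProbabilityMeasure μ' :=
    isProbabilityMeasure_wilsonMeasure (d := 3) (L := L) (fundamentalRep (Fin 2)) (continuous_fundamentalRep (Fin 2)) β'
  have hup := torus_concentration_su2_uniform hβ L Λ hinj f hf ℓ hℓ hS hLip hr
  have hf' : ContDiff ℝ ∞ (fun m => - f m) := hf.neg
  have hLip' : ∀ (e : ↥Λ) (M M' : ↥Λ → Matrix.specialUnitaryGroup (Fin 2) ℂ), (∀ e', e' ≠ e → M e' = M' e') →
      |(fun m => - f m) (fun e' => (M e' : Matrix (Fin 2) (Fin 2) ℂ)) -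
          (fun m => - f m) (fun e' => (M' e' : Matrix (Fin 2) (Fin 2) ℂ))| ≤ ℓ e * suFrobDist (M e) (M' e) := by
    intro e M M' h
    simp only [neg_sub_neg]
    rw [abs_sub_comm]
    exact hLip e M M' h
  have hlow := torus_concentration_su2_uniform hβ L Λ hinj (fun m => - f m) hf' ℓ hℓ hS hLip' hr
  have hF' : ∀ V : (GaugeConfig 3 L (Matrix.specialUnitaryGroup (Fin 2) ℂ)), matrixCylinder Λ (fun m => - f m) (torusLift L V) = - matrixCylinder Λ f (torusLift L V) := fun V => rfl
  simp_rw [hF'] at hlow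
  rw [integral_neg] at hlow
  have hsub : {V : (GaugeConfig 3 L (Matrix.specialUnitaryGroup (Fin 2) ℂ)) | r ≤ |matrixCylinder Λ f (torusLift L V) - ∫ V', matrixCylinder Λ f (torusLift L V') ∂μ'|} ⊆
      {V | (∫ V', matrixCylinder Λ f (torusLift L V') ∂μ') + r ≤ matrixCylinder Λ f (torusLift L V)} ∪
        {V | -(∫ V', matrixCylinder Λ f (torusLift L V') ∂μ') + r ≤ - matrixCylinder Λ f (torusLift L V)} := by
    intro V hV
    simp only [mem_setOf_eq, mem_union] at hV ⊢
    rcases le_abs'.1 hV with h | h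
    · right; linarith
    · left; linarith
  calc μ'.real {V : (GaugeConfig 3 L (Matrix.specialUnitaryGroup (Fin 2) ℂ)) | r ≤ |matrixCylinder Λ f (torusLift L V) - ∫ V', matrixCylinder Λ f (torusLift L V') ∂μ'|}
      ≤ μ'.real ({V | (∫ V', matrixCylinder Λ f (torusLift L V') ∂μ') + r ≤ matrixCylinder Λ f (torusLift L V)} ∪
          {V | -(∫ V', matrixCylinder Λ f (torusLift L V') ∂μ') + r ≤ - matrixCylinder Λ f (torusLift L V)}) := measureReal_mono hsub
    _ ≤ μ'.real {V | (∫ V', matrixCylinder Λ f (torusLift L V') ∂μ') + r ≤ matrixCylinder Λ f (torusLift L V)} +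
          μ'.real {V | -(∫ V', matrixCylinder Λ f (torusLift L V') ∂μ') + r ≤ - matrixCylinder Λ f (torusLift L V)} :=
        measureReal_union_le _ _
    _ ≤ Real.exp (-((1 - 12 * |β'|) * r ^ 2 / (2 * ∑ e, ℓ e ^ 2))) +
          Real.exp (-((1 - 12 * |β'|) * r ^ 2 / (2 * ∑ e, ℓ e ^ 2))) := add_le_add hup hlow
    _ = 2 * Real.exp (-((1 - 12 * |β'|) * r ^ 2 / (2 * ∑ e, ℓ e ^ 2))) := by ring

/-! ## §2. Calculus of link-Lipschitz cylinder functions: restriction to a larger link set, loop families -/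

/-- **Restriction**: a smooth cylinder function over `Λ₁ ⊆ Λ` that is `ℓ_e`-Lipschitz in the links of `Λ₁` is a smooth cylinder function over `Λ`,
`ℓ_e`-Lipschitz in the links of `Λ₁` and `0`-Lipschitz in the other links of `Λ`. [folklore] -/
theorem exists_smooth_linkLipschitz_extend {d N : ℕ} {Λ₁ Λ : Finset (Literature.MathematicalPhysics.QuantumLattice.ZdEdge d)}
    (hsub : Λ₁ ⊆ Λ) (f₁ : (↥Λ₁ → Matrix (Fin N) (Fin N) ℂ) → ℝ) (hf₁ : ContDiff ℝ ∞ f₁) (ℓ₁ : ↥Λ₁ → ℝ)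
    (hLip₁ : ∀ (e : ↥Λ₁) (M M' : ↥Λ₁ → Matrix.specialUnitaryGroup (Fin N) ℂ), (∀ e', e' ≠ e → M e' = M' e') →
      |f₁ (fun e' => (M e' : Matrix (Fin N) (Fin N) ℂ)) - f₁ (fun e' => (M' e' : Matrix (Fin N) (Fin N) ℂ))| ≤
        ℓ₁ e * suFrobDist (M e) (M' e)) :
    ∃ f : (↥Λ → Matrix (Fin N) (Fin N) ℂ) → ℝ,
      ContDiff ℝ ∞ f ∧
      (∀ U : LGConfig d (Matrix.specialUnitaryGroup (Fin N) ℂ), matrixCylinder Λ f U = matrixCylinder Λ₁ f₁ U) ∧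
      (∀ (e : ↥Λ) (M M' : ↥Λ → Matrix.specialUnitaryGroup (Fin N) ℂ), (∀ e', e' ≠ e → M e' = M' e') →
        |f (fun e' => (M e' : Matrix (Fin N) (Fin N) ℂ)) - f (fun e' => (M' e' : Matrix (Fin N) (Fin N) ℂ))| ≤
          (if h : (e : Literature.MathematicalPhysics.QuantumLattice.ZdEdge d) ∈ Λ₁ then ℓ₁ ⟨e, h⟩ else 0) *
            suFrobDist (M e) (M' e)) := by
  classical
  refine ⟨fun m => f₁ (fun e₁ : ↥Λ₁ => m ⟨e₁.1, hsub e₁.2⟩), ?_, fun U => rfl, fun e M M' hMM' => ?_⟩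
  · exact hf₁.comp (contDiff_pi.2 fun e₁ : ↥Λ₁ => contDiff_apply ℝ (Matrix (Fin N) (Fin N) ℂ) (⟨e₁.1, hsub e₁.2⟩ : ↥Λ))
  · by_cases he : (e : Literature.MathematicalPhysics.QuantumLattice.ZdEdge d) ∈ Λ₁
    · rw [dif_pos he]
      have hagree : ∀ e₁' : ↥Λ₁, e₁' ≠ ⟨e, he⟩ →
          (fun e₁ : ↥Λ₁ => M ⟨e₁.1, hsub e₁.2⟩) e₁' = (fun e₁ : ↥Λ₁ => M' ⟨e₁.1, hsub e₁.2⟩) e₁' := by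
        intro e₁' hne
        have hne' : (⟨e₁'.1, hsub e₁'.2⟩ : ↥Λ) ≠ e := by
          intro h
          have hval : (e₁' : Literature.MathematicalPhysics.QuantumLattice.ZdEdge d) =
              (e : Literature.MathematicalPhysics.QuantumLattice.ZdEdge d) := congrArg Subtype.val h
          exact hne (Subtype.ext hval)
        exact hMM' _ hne'
      have h := hLip₁ ⟨e, he⟩ (fun e₁ : ↥Λ₁ => M ⟨e₁.1, hsub e₁.2⟩) (fun e₁ : ↥Λ₁ => M' ⟨e₁.1, hsub e₁.2⟩) hagree
      simpa using h
    · rw [dif_neg he, zero_mul]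
      have hall : (fun e₁ : ↥Λ₁ => ((M ⟨e₁.1, hsub e₁.2⟩ : Matrix.specialUnitaryGroup (Fin N) ℂ) : Matrix (Fin N) (Fin N) ℂ)) =
          fun e₁ : ↥Λ₁ => ((M' ⟨e₁.1, hsub e₁.2⟩ : Matrix.specialUnitaryGroup (Fin N) ℂ) : Matrix (Fin N) (Fin N) ℂ) := by
        funext e₁
        have hne' : (⟨e₁.1, hsub e₁.2⟩ : ↥Λ) ≠ e := fun h => he (by rw [← congrArg Subtype.val h]; exact e₁.2)
        rw [hMM' _ hne']
      simp only [hall, sub_self, abs_zero, le_refl]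

/-- **Linear combinations of Wilson loops are smooth link-Lipschitz cylinder functions**: for a finite family of closed lattice walks `C_k` and
coefficients `a_k`, `A = Σ_k a_k W_{C_k}` (`W_C = (1/N) Re tr hol_C`) is `matrixCylinder Λ f` over `Λ = ⋃_k links(C_k)` with `f` smooth and
`(Σ_k |a_k| mult_{C_k}(e))/√N`-Lipschitz in the link `e`. [folklore] -/
theorem exists_smooth_linkLipschitz_loopFamily {d N : ℕ} {ι : Type*} (s : Finset ι) {x : ι → Site d}
    (C : ∀ k, (zdGraph d).Walk (x k) (x k)) (a : ι → ℝ) :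
    ∃ f : (↥(s.biUnion fun k => walkEdges (C k)) → Matrix (Fin N) (Fin N) ℂ) → ℝ,
      ContDiff ℝ ∞ f ∧
      (∀ U : LGConfig d (Matrix.specialUnitaryGroup (Fin N) ℂ),
        matrixCylinder (s.biUnion fun k => walkEdges (C k)) f U =
          ∑ k ∈ s, a k * wilsonLoopObs (fun g : Matrix.specialUnitaryGroup (Fin N) ℂ => normalisedCharacter N (fundamentalRep (Fin N) g))
            (C k) U) ∧
      (∀ (e : ↥(s.biUnion fun k => walkEdges (C k))) (M M' : ↥(s.biUnion fun k => walkEdges (C k)) → Matrix.specialUnitaryGroup (Fin N) ℂ),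
        (∀ e', e' ≠ e → M e' = M' e') →
        |f (fun e' => (M e' : Matrix (Fin N) (Fin N) ℂ)) - f (fun e' => (M' e' : Matrix (Fin N) (Fin N) ℂ))| ≤
          (∑ k ∈ s, |a k| * (dartMult (C k) (e : Literature.MathematicalPhysics.QuantumLattice.ZdEdge d) : ℝ)) / Real.sqrt (N : ℝ) *
            suFrobDist (M e) (M' e)) := by
  classical
  set Λ : Finset (Literature.MathematicalPhysics.QuantumLattice.ZdEdge d) := s.biUnion fun k => walkEdges (C k) with hΛ
  -- one smooth Lipschitz representative per loop, over the common link set `Λ`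
  have hk : ∀ k : ↥s, ∃ g : (↥Λ → Matrix (Fin N) (Fin N) ℂ) → ℝ, ContDiff ℝ ∞ g ∧
      (∀ U : LGConfig d (Matrix.specialUnitaryGroup (Fin N) ℂ), matrixCylinder Λ g U =
        wilsonLoopObs (fun g : Matrix.specialUnitaryGroup (Fin N) ℂ => normalisedCharacter N (fundamentalRep (Fin N) g)) (C k) U) ∧
      (∀ (e : ↥Λ) (M M' : ↥Λ → Matrix.specialUnitaryGroup (Fin N) ℂ), (∀ e', e' ≠ e → M e' = M' e') →
        |g (fun e' => (M e' : Matrix (Fin N) (Fin N) ℂ)) - g (fun e' => (M' e' : Matrix (Fin N) (Fin N) ℂ))| ≤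
          (dartMult (C k) (e : Literature.MathematicalPhysics.QuantumLattice.ZdEdge d) : ℝ) / Real.sqrt (N : ℝ) * suFrobDist (M e) (M' e)) := by
    intro k
    obtain ⟨f₁, hf₁, hrep₁, hLip₁⟩ := exists_smooth_linkLipschitz_wilsonLoopObs (N := N) (C k)
    have hsub : walkEdges (C k) ⊆ Λ := by
      rw [hΛ]; exact Finset.subset_biUnion_of_mem (fun k => walkEdges (C k)) k.2
    obtain ⟨g, hg, hrepg, hLipg⟩ := exists_smooth_linkLipschitz_extend hsub f₁ hf₁
      (fun e => (dartMult (C k) (e : Literature.MathematicalPhysics.QuantumLattice.ZdEdge d) : ℝ) / Real.sqrt (N : ℝ)) hLip₁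
    refine ⟨g, hg, fun U => by rw [hrepg, hrep₁], fun e M M' h => (hLipg e M M' h).trans (le_of_eq ?_)⟩
    by_cases he : (e : Literature.MathematicalPhysics.QuantumLattice.ZdEdge d) ∈ walkEdges (C k)
    · rw [dif_pos he]
    · rw [dif_neg he, dartMult_eq_zero_of_not_mem (C k) he, Nat.cast_zero, zero_div]
  choose g hg using hk
  refine ⟨fun m => ∑ k ∈ s.attach, a k * g k m, ?_, ?_, ?_⟩
  · exact ContDiff.sum fun k _ => contDiff_const.mul (hg k).1
  · intro U
    have h1 : matrixCylinder Λ (fun m => ∑ k ∈ s.attach, a k * g k m) U = ∑ k ∈ s.attach, a k * matrixCylinder Λ (g k) U := rfl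
    rw [h1]
    simp_rw [(hg _).2.1]
    exact Finset.sum_attach s (fun k => a k *
      wilsonLoopObs (fun g : Matrix.specialUnitaryGroup (Fin N) ℂ => normalisedCharacter N (fundamentalRep (Fin N) g)) (C k) U)
  · intro e M M' hMM'
    have hterm : ∀ k ∈ s.attach, |a k * g k (fun e' => (M e' : Matrix (Fin N) (Fin N) ℂ)) - a k * g k (fun e' => (M' e' : Matrix (Fin N) (Fin N) ℂ))| ≤
        |a k| * ((dartMult (C k) (e : Literature.MathematicalPhysics.QuantumLattice.ZdEdge d) : ℝ) / Real.sqrt (N : ℝ) *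
          suFrobDist (M e) (M' e)) := by
      intro k _
      rw [← mul_sub, abs_mul]
      exact mul_le_mul_of_nonneg_left ((hg k).2.2 e M M' hMM') (abs_nonneg _)
    calc |∑ k ∈ s.attach, a k * g k (fun e' => (M e' : Matrix (Fin N) (Fin N) ℂ)) -
            ∑ k ∈ s.attach, a k * g k (fun e' => (M' e' : Matrix (Fin N) (Fin N) ℂ))|
        = |∑ k ∈ s.attach, (a k * g k (fun e' => (M e' : Matrix (Fin N) (Fin N) ℂ)) -
            a k * g k (fun e' => (M' e' : Matrix (Fin N) (Fin N) ℂ)))| := by rw [Finset.sum_sub_distrib]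
      _ ≤ ∑ k ∈ s.attach, |a k * g k (fun e' => (M e' : Matrix (Fin N) (Fin N) ℂ)) -
            a k * g k (fun e' => (M' e' : Matrix (Fin N) (Fin N) ℂ))| := Finset.abs_sum_le_sum_abs _ _
      _ ≤ ∑ k ∈ s.attach, |a k| * ((dartMult (C k) (e : Literature.MathematicalPhysics.QuantumLattice.ZdEdge d) : ℝ) / Real.sqrt (N : ℝ) *
            suFrobDist (M e) (M' e)) := Finset.sum_le_sum hterm
      _ = (∑ k ∈ s, |a k| * (dartMult (C k) (e : Literature.MathematicalPhysics.QuantumLattice.ZdEdge d) : ℝ)) / Real.sqrt (N : ℝ) *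
            suFrobDist (M e) (M' e) := by
          rw [Finset.sum_div, Finset.sum_mul,
            ← Finset.sum_attach s (fun k => |a k| * (dartMult (C k) (e : Literature.MathematicalPhysics.QuantumLattice.ZdEdge d) : ℝ) /
              Real.sqrt (N : ℝ) * suFrobDist (M e) (M' e))]
          refine Finset.sum_congr rfl fun k _ => ?_
          ring

/-! ## §3. Loop families: Gaussian concentration under every limit point and on every torus -/

/-- ★★★ **Gaussian concentration of linear combinations of Wilson loops** under every infinite-volume limit point of `SU(2)` lattice Yang–Mills on
`ℤ³` at 't Hooft coupling `|β| < 1/24`: for a finite family of closed lattice walks `C_k`, coefficients `a_k` and `A = Σ_k a_k W_{C_k}`,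
`μ{|A − ⟨A⟩_μ| ≥ r} ≤ 2 exp(−(1 − 24|β|) r² / Σ_{e ∈ ⋃ links(C_k)} (Σ_k |a_k| mult_{C_k}(e))²)` — e.g. the plaquette density of `n` plaquettes
(weights `1/n`, every link in at most `4` of them): denominator `≤ 64/n`, Gaussian self-averaging.  Strong coupling, fixed lattice; the Yang–Mills
mass gap is NOT proved. [cite: ShenZhuZhu2022, Theorem 1.4, Corollary 4.8] -/
theorem szz_loopFamily_twoSided_su2 {β : ℝ} (hβ : |β| < 1 / 24)
    {μ : Measure (LGConfig 3 (Matrix.specialUnitaryGroup (Fin 2) ℂ))}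
    (hμ : μ ∈ infiniteVolumeLimitPoints (d := 3) (fundamentalRep (Fin 2)) (((2 : ℕ) : ℝ) * β))
    {ι : Type*} (s : Finset ι) {x : ι → Site 3} (C : ∀ k, (zdGraph 3).Walk (x k) (x k)) (a : ι → ℝ)
    (hS : 0 < ∑ e ∈ s.biUnion (fun k => walkEdges (C k)), (∑ k ∈ s, |a k| * (dartMult (C k) e : ℝ)) ^ 2)
    {r : ℝ} (hr : 0 ≤ r) :
    μ.real {U | r ≤ |(∑ k ∈ s, a k *
        wilsonLoopObs (fun g : Matrix.specialUnitaryGroup (Fin 2) ℂ => normalisedCharacter 2 (fundamentalRep (Fin 2) g)) (C k) U) -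
        ∫ V, ∑ k ∈ s, a k *
          wilsonLoopObs (fun g : Matrix.specialUnitaryGroup (Fin 2) ℂ => normalisedCharacter 2 (fundamentalRep (Fin 2) g)) (C k) V ∂μ|} ≤
      2 * Real.exp (-((1 - 24 * |β|) * r ^ 2 /
        ∑ e ∈ s.biUnion (fun k => walkEdges (C k)), (∑ k ∈ s, |a k| * (dartMult (C k) e : ℝ)) ^ 2)) := by
  classical
  obtain ⟨f, hf, hrep, hLip⟩ := exists_smooth_linkLipschitz_loopFamily (N := 2) s C a
  set ℓ : ↥(s.biUnion fun k => walkEdges (C k)) → ℝ := fun e =>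
    (∑ k ∈ s, |a k| * (dartMult (C k) (e : Literature.MathematicalPhysics.QuantumLattice.ZdEdge 3) : ℝ)) / Real.sqrt ((2 : ℕ) : ℝ) with hℓdef
  have hℓ : ∀ e, 0 ≤ ℓ e := fun e =>
    div_nonneg (Finset.sum_nonneg fun k _ => mul_nonneg (abs_nonneg _) (Nat.cast_nonneg _)) (Real.sqrt_nonneg _)
  have hsum : 2 * ∑ e, ℓ e ^ 2 = ∑ e ∈ s.biUnion (fun k => walkEdges (C k)), (∑ k ∈ s, |a k| * (dartMult (C k) e : ℝ)) ^ 2 := by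
    have h2 : Real.sqrt ((2 : ℕ) : ℝ) ^ 2 = 2 := by rw [Real.sq_sqrt (Nat.cast_nonneg _)]; norm_num
    simp only [hℓdef, div_pow, h2]
    rw [← Finset.sum_div, Finset.sum_coe_sort (s.biUnion fun k => walkEdges (C k))
      (fun e => (∑ k ∈ s, |a k| * (dartMult (C k) e : ℝ)) ^ 2)]
    ring
  have hS' : 0 < ∑ e, ℓ e ^ 2 := by linarith
  have h := szz_twoSided_su2_sharp hβ hμ (s.biUnion fun k => walkEdges (C k)) f hf ℓ hℓ hS' hLip hr
  have hF : matrixCylinder (s.biUnion fun k => walkEdges (C k)) f = fun U => ∑ k ∈ s, a k *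
      wilsonLoopObs (fun g : Matrix.specialUnitaryGroup (Fin 2) ℂ => normalisedCharacter 2 (fundamentalRep (Fin 2) g)) (C k) U :=
    funext hrep
  rw [hF, hsum] at h
  exact h

/-- ★★★ **Gaussian concentration of linear combinations of Wilson loops on every torus, uniformly in the volume, `|β'| < 1/12`**: for a finite
family of closed lattice walks `C_k` whose joint link set stays injective on `(ℤ/L)³`, coefficients `a_k` and `A = Σ_k a_k W_{C_k}` read through the
periodic lift, `μ_{L,β'}{|A − ⟨A⟩| ≥ r} ≤ 2 exp(−(1 − 12|β'|) r² / Σ_e (Σ_k |a_k| mult_{C_k}(e))²)`, the same in every volume.  Strong coupling, fixed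
lattice; the Yang–Mills mass gap is NOT proved. [cite: ShenZhuZhu2022, Corollary 4.4 (4.11), Corollary 4.8] -/
theorem torus_loopFamily_twoSided_su2_uniform {β' : ℝ} (hβ : |β'| < 1 / 12) (L : ℕ) [NeZero L]
    {ι : Type*} (s : Finset ι) {x : ι → Site 3} (C : ∀ k, (zdGraph 3).Walk (x k) (x k)) (a : ι → ℝ)
    (hinj : Set.InjOn (torusEdge (d := 3) L) ↑(s.biUnion (fun k => walkEdges (C k))))
    (hS : 0 < ∑ e ∈ s.biUnion (fun k => walkEdges (C k)), (∑ k ∈ s, |a k| * (dartMult (C k) e : ℝ)) ^ 2)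
    {r : ℝ} (hr : 0 ≤ r) :
    ((wilsonMeasure (d := 3) (L := L) (fundamentalRep (Fin 2)) β')).real {V | r ≤ |(∑ k ∈ s, a k *
        wilsonLoopObs (fun g : Matrix.specialUnitaryGroup (Fin 2) ℂ => normalisedCharacter 2 (fundamentalRep (Fin 2) g)) (C k)
          (torusLift L V)) -
        ∫ V', ∑ k ∈ s, a k *
          wilsonLoopObs (fun g : Matrix.specialUnitaryGroup (Fin 2) ℂ => normalisedCharacter 2 (fundamentalRep (Fin 2) g)) (C k)
            (torusLift L V') ∂(wilsonMeasure (d := 3) (L := L) (fundamentalRep (Fin 2)) β')|} ≤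
      2 * Real.exp (-((1 - 12 * |β'|) * r ^ 2 /
        ∑ e ∈ s.biUnion (fun k => walkEdges (C k)), (∑ k ∈ s, |a k| * (dartMult (C k) e : ℝ)) ^ 2)) := by
  classical
  obtain ⟨f, hf, hrep, hLip⟩ := exists_smooth_linkLipschitz_loopFamily (N := 2) s C a
  set ℓ : ↥(s.biUnion fun k => walkEdges (C k)) → ℝ := fun e =>
    (∑ k ∈ s, |a k| * (dartMult (C k) (e : Literature.MathematicalPhysics.QuantumLattice.ZdEdge 3) : ℝ)) / Real.sqrt ((2 : ℕ) : ℝ) with hℓdef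
  have hℓ : ∀ e, 0 ≤ ℓ e := fun e =>
    div_nonneg (Finset.sum_nonneg fun k _ => mul_nonneg (abs_nonneg _) (Nat.cast_nonneg _)) (Real.sqrt_nonneg _)
  have hsum : 2 * ∑ e, ℓ e ^ 2 = ∑ e ∈ s.biUnion (fun k => walkEdges (C k)), (∑ k ∈ s, |a k| * (dartMult (C k) e : ℝ)) ^ 2 := by
    have h2 : Real.sqrt ((2 : ℕ) : ℝ) ^ 2 = 2 := by rw [Real.sq_sqrt (Nat.cast_nonneg _)]; norm_num
    simp only [hℓdef, div_pow, h2]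
    rw [← Finset.sum_div, Finset.sum_coe_sort (s.biUnion fun k => walkEdges (C k))
      (fun e => (∑ k ∈ s, |a k| * (dartMult (C k) e : ℝ)) ^ 2)]
    ring
  have hS' : 0 < ∑ e, ℓ e ^ 2 := by linarith
  have h := torus_twoSided_su2_uniform hβ L (s.biUnion fun k => walkEdges (C k)) hinj f hf ℓ hℓ hS' hLip hr
  have hF : ∀ V : (GaugeConfig 3 L (Matrix.specialUnitaryGroup (Fin 2) ℂ)), matrixCylinder (s.biUnion fun k => walkEdges (C k)) f (torusLift L V) = ∑ k ∈ s, a k *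
      wilsonLoopObs (fun g : Matrix.specialUnitaryGroup (Fin 2) ℂ => normalisedCharacter 2 (fundamentalRep (Fin 2) g)) (C k)
        (torusLift L V) := fun V => hrep _
  simp_rw [hF] at h
  rw [hsum] at h
  exact h

end Summit.QuantumFields.YangMills.Theorems.ColdStartUniversality

end
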